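import Summits.MatrixMultiplication.MatrixMultiplication.Theorems.EdgePencilSixthConvexity
import HarnessLib

/-!
# Matrix-multiplication covers of the sixth-edge rung are HalfAlpha-complete

Helper kernel for `stmt-MatrixMultiplication-26697` (`TetraExcessZero : ω(K₄) ≤ ω(2,1,2)`), rung side
`SixRungPos : ∃ δ > 0, χ(δ) ≤ ψ` of the registered skeleton `Cruxes/TetraExcessZero/Lines/rung_and_chord`
(`χ = omegaSix`, `ψ = ω(2,1,2) = 2ω(1,1,½)`).  Pure exponent arithmetic, no tensors.

THE MECHANISM that realises the rung when `ω = 2` is the RE-ROUTING COVER: the thin pendant `01`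
(bond `n^δ`) rides on a small Coppersmith-flat triangle `⟨n^x, n^x, n^δ⟩` on `{0,1,2}`, which also
carries `n^x` of the bonds `02, 12`, so the diamond's two triangles shrink to `⟨n^{1-x}, n, n^{1/2}⟩`:
bondwise `W^{(δ)} = Tri₀₁₂(δ,x,x) ⊠ Tri₀₂₃(1-x,1,½) ⊠ Tri₁₂₃(1-x,1,½)` (CVZ19 §1.1), whence the
value-free bound `χ(δ) ≤ ω(x,x,δ) + 2ω(1-x,1,½)` and the rung as soon as the right side is
`≤ ω(2,1,2)` — the RE-ROUTING CERTIFICATE.  This file decides the strength of such certificates: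

* §1 `omegaRect_one_one_eq_two_of_lrTight` — LOTTI–ROMANI BLOCKING IS STRICT ABOVE `α`: if
  `ω(1-x,1,s) + x ≤ ω(1,1,s)` for some `x ∈ (0,1]` and some `a ∈ (0,s)` is flat (`ω(1,1,a) = 2`), then
  `ω(1,1,s) = 2` (symmetry + subadditivity + homogeneity make tightness the exact right slope
  `(ω(1,1,s) − 2)/s` of `c ↦ ω(1,1,c)` at `s`; convexity through `a` forbids it unless `ω(1,1,s) = 2`).
* §2 `halfAlpha_of_reroutingCertificate` — the certificate (any `x ∈ (0,1]`, any `δ`) is LR-tight at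
  `(1,1,½)` since `ω(x,x,δ) ≥ 2x`; with Coppersmith's flat point, `ω(1,1,½) = 2`, i.e. `HalfAlpha`.
* §3 `reroutingCertificate_of_half_lt_dualExponentAlpha` — conversely `½ < α` yields the certificate
  (`x = 1 − 1/(2α)`, `δ = x·α₀`); §4 `sixRungPos_of_reroutingBound_of_half_lt` — with the cover bound
  as a hypothesis, `½ < α` gives `SixRungPos`, and the rung so certified is absolute (`χ(δ) ≤ 4`).
* §5 `half_le_dualExponentAlpha_of_placedCover` / `halfAlpha_of_placedCoverCertificate` — THE GENERAL
  COUNT: every placed matrix-multiplication cover of `W^{(δ)}` (finitely many rectangular triangles on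
  the triples `012, 013, 023, 123`, nonnegative loads summing to the bonds `01:δ; 02,03,12,13,23:1`)
  of cost `≤ ω(2,1,2)` forces `α ≥ ½`, for ANY `δ > 0`.

NET (negative knowledge for the crux chain).  The mass count `weightedCover_ceiling`
(`(5+δ)·ω ≤ 3·ω(2,1,2)`) is vacuous for `δ ≤ 0.17`; the placed count closes the cover class at every
`δ`: `½ < α ⟹ (some cover certifies some rung) ⟹ ½ ≤ α`.  Up to the boundary case `α = ½`,
matrix-multiplication covers certify `SixRungPos` exactly in the HalfAlpha world, so every
cover-certified rung is inside trap T1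
(`absRung_iff_halfAlpha_and_sixRungPos`); an attack by re-insertion of the pendant must use a
constituent that is not a rectangular matrix multiplication on ≤ 3 parties (or a value / rigidity
statement), not a cleverer placement or a smaller `δ`.
[cite: LottiRomani1983, §1–§2 (pp. 173–174)] [cite: BurgisserClausenShokrollahi1997, Thm. (15.51)]
[cite: ChristandlVranaZuiddam2016, §1.1]
-/

set_option linter.dupNamespace false

open Literature.Computability.AlgebraicComplexity
open Summit.MatrixMultiplication.MatrixMultiplication.Theorems.TetrahedronTensor
open Summit.MatrixMultiplication.MatrixMultiplication.Theses.TetrahedronCarving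

namespace Summit.MatrixMultiplication.MatrixMultiplication.Theorems.EdgePencil

/-! ## §1 Lotti–Romani tightness in a unit slot forces flatness -/

section LRTight

variable (K : Type) [Field K]

/-- **LR-tightness ⟹ flatness.** If `0 < a < s`, `ω(1,1,a) = 2`, and for some `0 < x ≤ 1` the
Lotti–Romani blocking bound is tight at the thin triangle, `ω(1-x,1,s) + x ≤ ω(1,1,s)`, then
`ω(1,1,s) = 2`.  (Symmetry `ω(1-x,1,s) = ω(1,1-x,s)`, subadditivity
`ω(2-x,2-x,2s) ≤ ω(1-x,1,s) + ω(1,1-x,s)`, homogeneity `ω(2-x,2-x,2s) = (2-x)·ω(1,1,2s/(2-x))`, and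
convexity of `c ↦ ω(1,1,c)` through `a < s < 2s/(2-x)`.) [cite: LottiRomani1983, §1–§2 (pp. 173–174)] -/
theorem omegaRect_one_one_eq_two_of_lrTight {a s x : ℝ} (ha : 0 < a) (has : a < s) (hx : 0 < x)
    (hx1 : x ≤ 1) (hflat : omegaRect K 1 1 a = 2)
    (htight : omegaRect K (1 - x) 1 s + x ≤ omegaRect K 1 1 s) : omegaRect K 1 1 s = 2 := by
  have hs : 0 < s := ha.trans has
  set F := omegaRect K 1 1 s with hF
  -- symmetry and subadditivity: ω(2-x, 2-x, 2s) ≤ 2 ω(1-x,1,s) ≤ 2F - 2x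
  have hsym : omegaRect K 1 (1 - x) s = omegaRect K (1 - x) 1 s := omegaRect_swap₁₂ K 1 (1 - x) s
  have hsub := LottiRomani1983_subadditive K (1 - x) 1 s 1 (1 - x) s
  have h2x : omegaRect K (2 - x) (2 - x) (2 * s) ≤ 2 * F - 2 * x := by
    have e1 : (1 - x) + 1 = 2 - x := by ring
    have e2 : (1 : ℝ) + (1 - x) = 2 - x := by ring
    have e3 : s + s = 2 * s := by ring
    rw [e1, e2, e3, hsym] at hsub
    linarith
  -- homogeneity: ω(2-x,2-x,2s) = (2-x) ω(1,1,c), c = 2s/(2-x)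
  have h2x0 : 0 < 2 - x := by linarith
  set c := 2 * s / (2 - x) with hc
  have hcmul : (2 - x) * c = 2 * s := by
    rw [hc]; field_simp
  have hc0 : 0 ≤ c := by rw [hc]; positivity
  have hhom := LottiRomani1983_homogeneous K (ν := 2 - x) (x := 1) (y := 1) (z := c) h2x0.le
    zero_le_one zero_le_one hc0
  rw [mul_one, hcmul] at hhom
  -- so (2-x) G ≤ 2F - 2x with G = ω(1,1,c)
  set G := omegaRect K 1 1 c with hG
  have hG2 : (2 - x) * G ≤ 2 * F - 2 * x := by rw [← hhom]; exact h2x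
  -- convexity of q ↦ ω(1,1,q) at a < s < c
  have hsc : s < c := by
    rw [hc, lt_div_iff₀ h2x0]; nlinarith
  have hca : 0 < c - a := by linarith
  have hconv := (omegaRect_convexOn_one_one K).2 (Set.mem_Ici.2 ha.le) (Set.mem_Ici.2 hc0)
    (div_nonneg (sub_nonneg.2 hsc.le) hca.le) (div_nonneg (sub_nonneg.2 has.le) hca.le)
    (by field_simp; ring)
  simp only [smul_eq_mul] at hconv
  have hpt : (c - s) / (c - a) * a + (s - a) / (c - a) * c = s := by
    field_simp; ring
  rw [hpt, hflat] at hconv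
  -- hconv : F ≤ (c-s)/(c-a) * 2 + (s-a)/(c-a) * G ; clear denominators
  have hconv' : F * (c - a) ≤ (c - s) * 2 + (s - a) * G := by
    have := mul_le_mul_of_nonneg_right hconv hca.le
    have e : ((c - s) / (c - a) * 2 + (s - a) / (c - a) * G) * (c - a) = (c - s) * 2 + (s - a) * G := by
      field_simp
    linarith [e]
  have hF2 : 2 ≤ F := two_le_omegaRect_one_one K s
  have hG2' : 2 ≤ G := two_le_omegaRect_one_one K c
  -- elimination (see the docstring): F · a · x ≤ 2 · a · x
  have key : F * (a * x) ≤ 2 * (a * x) := by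
    nlinarith [hconv', hG2, hcmul, mul_pos ha hx, sub_nonneg.2 has.le, h2x0]
  have hax : 0 < a * x := mul_pos ha hx
  exact le_antisymm (le_of_mul_le_mul_right key hax) hF2

end LRTight

/-! ## §2 The re-routing certificate forces HalfAlpha -/

/-- `ω(2,1,2) = 2 ω(1,1,½)` (symmetry and homogeneity). [cite: LottiRomani1983, §1 (p. 173)] -/
theorem omegaRect_two_one_two_eq_two_mul_half (K : Type) [Field K] :
    omegaRect K 2 1 2 = 2 * omegaRect K 1 1 (1 / 2) := by
  have h := LottiRomani1983_homogeneous K (ν := 2) (x := 1) (y := 1) (z := 1 / 2) zero_le_two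
    zero_le_one zero_le_one (by norm_num)
  rw [omegaRect_swap₂₃ K 2 1 2, ← h]
  norm_num

/-- **The re-routing certificate is at least HalfAlpha.** If for some `0 < x ≤ 1` and some `δ` the
re-routing cover certifies the rung, `ω(x,x,δ) + 2ω(1-x,1,½) ≤ ω(2,1,2)`, then `α ≥ ½`: the flattening bound
`ω(x,x,δ) ≥ 2x` makes the certificate an LR-tightness `ω(1-x,1,½) + x ≤ ω(1,1,½)`, and §1 with
Coppersmith's flat point `α₀ < ½` gives `ω(1,1,½) = 2`, i.e. `ω(2,1,2) = 4`.
[cite: BurgisserClausenShokrollahi1997, Thm. (15.51)] [cite: LottiRomani1983, §2 (p. 174)] -/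
theorem halfAlpha_of_reroutingCertificate
    (h : ∃ x δ : ℝ, 0 < x ∧ x ≤ 1 ∧
      omegaRect ℂ x x δ + 2 * omegaRect ℂ (1 - x) 1 (1 / 2) ≤ omegaRect ℂ 2 1 2) : HalfAlpha := by
  obtain ⟨x, δ, hx, hx1, hcert⟩ := h
  have hflat2x : x + x ≤ omegaRect ℂ x x δ := add_le_omegaRect₁₂ ℂ x x δ
  rw [omegaRect_two_one_two_eq_two_mul_half ℂ] at hcert
  have htight : omegaRect ℂ (1 - x) 1 (1 / 2) + x ≤ omegaRect ℂ 1 1 (1 / 2) := by linarith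
  have hhalf : omegaRect ℂ 1 1 (1 / 2) = 2 :=
    omegaRect_one_one_eq_two_of_lrTight ℂ coppersmithExponent_pos
      (by linarith [coppersmithExponent_lt]) hx hx1 (coppersmith1982_omegaRect_eq_two ℂ) htight
  have hψ : omegaRect ℂ 2 1 2 ≤ 4 := by
    rw [omegaRect_two_one_two_eq_two_mul_half ℂ, hhalf]; norm_num
  exact (omegaRect_two_one_two_le_four_iff_half_le_dualExponentAlpha ℂ).1 hψ

/-! ## §3 Conversely, strict HalfAlpha yields the certificate -/

/-- **`½ < α ⟹` the re-routing certificate**, with `x = 1 - 1/(2α) ∈ (0, ½]` and `δ = x·α₀ > 0`: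
`ω(x,x,xα₀) = x·ω(1,1,α₀) = 2x` (homogeneity, Coppersmith) and
`ω(1-x,1,½) = (1-x)·ω(1, 2α, α) ≤ (1-x)(ω(1,1,α) + 2α - 1) = (1-x)(1 + 2α) = 2 - x`
(homogeneity, Lotti–Romani, `ω(1,1,α) = 2`), total `4 ≤ ω(2,1,2)`.
[cite: LottiRomani1983, §1 (p. 173)] [cite: BurgisserClausenShokrollahi1997, Thm. (15.51)] -/
theorem reroutingCertificate_of_half_lt_dualExponentAlpha (K : Type) [Field K]
    (hα : 1 / 2 < dualExponentAlpha K) :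
    ∃ x δ : ℝ, 0 < x ∧ x ≤ 1 ∧ 0 < δ ∧ δ ≤ x ∧
      omegaRect K x x δ + 2 * omegaRect K (1 - x) 1 (1 / 2) ≤ omegaRect K 2 1 2 := by
  set α := dualExponentAlpha K with hαdef
  have hα0 : 0 < α := by linarith
  have hα1 : α ≤ 1 := dualExponentAlpha_le_one K
  set x := 1 - 1 / (2 * α) with hxdef
  have hx0 : 0 < x := by
    rw [hxdef, sub_pos, div_lt_one (by positivity)]; linarith
  have hx1 : x ≤ 1 / 2 := by
    rw [hxdef]
    have : 1 / 2 ≤ 1 / (2 * α) := by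
      rw [div_le_div_iff₀ (by norm_num) (by positivity)]; nlinarith
    linarith
  refine ⟨x, x * coppersmithExponent, hx0, by linarith, mul_pos hx0 coppersmithExponent_pos, ?_, ?_⟩
  · have := coppersmithExponent_lt
    nlinarith
  -- the pendant triangle is flat: ω(x,x,xα₀) = 2x
  have hC : omegaRect K x x (x * coppersmithExponent) = 2 * x := by
    have h := LottiRomani1983_homogeneous K (ν := x) (x := 1) (y := 1) (z := coppersmithExponent)
      hx0.le zero_le_one zero_le_one coppersmithExponent_pos.le
    rw [mul_one] at h
    rw [h, coppersmith1982_omegaRect_eq_two K]; ring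
  -- the shrunk thin triangle: ω(1-x,1,½) ≤ 2 - x
  have hy : 1 - x = 1 / (2 * α) := by rw [hxdef]; ring
  have hy0 : 0 < 1 - x := by linarith
  have hT : omegaRect K (1 - x) 1 (1 / 2) ≤ 2 - x := by
    -- homogeneity with ν = 1 - x = 1/(2α): (1-x)·(1, 2α, α) = (1-x, 1, ½)
    have h := LottiRomani1983_homogeneous K (ν := 1 - x) (x := 1) (y := 2 * α) (z := α) hy0.le
      zero_le_one (by positivity) hα0.le
    have e2 : (1 - x) * (2 * α) = 1 := by rw [hy]; field_simp
    have e3 : (1 - x) * α = 1 / 2 := by rw [hy]; field_simp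
    rw [mul_one, e2, e3] at h
    -- ω(1, 2α, α) ≤ ω(1,1,α) + (2α - 1) = 2 + 2α - 1
    have hLR := omegaRect_add_le_add_pos K 1 1 α 0 (2 * α - 1) 0
    simp only [add_zero] at hLR
    have e4 : (1 : ℝ) + (2 * α - 1) = 2 * α := by ring
    rw [e4, max_eq_left (by linarith : (0 : ℝ) ≤ 2 * α - 1), max_self, zero_add, add_zero] at hLR
    have hflatα : omegaRect K 1 1 α = 2 := by
      rw [← omegaRect_one_mid_one K α]; exact omegaRect_dualExponentAlpha K
    rw [hflatα] at hLR
    -- h : ω(1-x,1,½) = (1-x) ω(1,2α,α)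
    rw [h]
    have : (1 - x) * omegaRect K 1 (2 * α) α ≤ (1 - x) * (2 + (2 * α - 1)) :=
      mul_le_mul_of_nonneg_left hLR hy0.le
    have e5 : (1 - x) * (2 + (2 * α - 1)) = 2 - x := by
      rw [hxdef]; field_simp; ring
    linarith
  have h4 : (4 : ℝ) ≤ omegaRect K 2 1 2 := four_le_omegaRect_two_one_two (F := K)
  rw [hC]
  linarith

/-! ## §4 What the re-routing cover bound would give -/

/-- **Re-routing under strict HalfAlpha gives the rung.** With the (value-free, unconditional, here
HYPOTHESISED) cover bound `χ(δ) ≤ ω(x,x,δ) + 2ω(1-x,1,½)` for `0 < δ ≤ x ≤ 1` — the bondwise identity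
`W^{(δ)} = Tri₀₁₂(δ,x,x) ⊠ Tri₀₂₃(1-x,1,½) ⊠ Tri₁₂₃(1-x,1,½)` (CVZ19 §1.1) — strict HalfAlpha `½ < α` yields
`SixRungPos`.  By §2 every rung so obtained is an absolute rung `χ(δ) ≤ 4` (trap T1 of the crux chain).
[cite: ChristandlVranaZuiddam2016, §1.1] -/
theorem sixRungPos_of_reroutingBound_of_half_lt
    (hB : ∀ x δ : ℝ, 0 < δ → δ ≤ x → x ≤ 1 →
      omegaSix ℂ δ ≤ omegaRect ℂ x x δ + 2 * omegaRect ℂ (1 - x) 1 (1 / 2))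
    (hα : (1 / 2 : ℝ) < dualExponentAlpha ℂ) :
    ∃ δ : ℝ, 0 < δ ∧ omegaSix ℂ δ ≤ omegaRect ℂ 2 1 2 ∧ omegaSix ℂ δ ≤ 4 := by
  obtain ⟨x, δ, hx, hx1, hδ, hδx, h⟩ := reroutingCertificate_of_half_lt_dualExponentAlpha ℂ hα
  have h4 : omegaRect ℂ 2 1 2 ≤ 4 :=
    (omegaRect_two_one_two_le_four_iff_half_le_dualExponentAlpha ℂ).2 hα.le
  exact ⟨δ, hδ, (hB x δ hδ hδx hx1).trans h, ((hB x δ hδ hδx hx1).trans h).trans h4⟩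

/-! ## §5 Every placed matrix-multiplication cover certificate of a rung forces HalfAlpha

A PLACED COVER of `W^{(δ)}` (bonds `01 : δ`; `02, 03, 12, 13, 23 : 1`): finitely many rectangular
matrix-multiplication triangles on the triples `012, 013, 023, 123`, nonnegative loads summing to the bonds
(EPR pairs and cherries are triangles with zero loads); bondwise Kronecker products restrict to `W^{(δ)}`,
so `χ(δ) ≤ cost = Σ ω(loads)`, and the cover CERTIFIES THE RUNG when `cost ≤ ω(2,1,2)`.  As in
`EdgePencilCoverCeiling` only the numerical certificate is quantified over.  Merging per triple
(subadditivity) gives the normal form `T₀₁₂(p,q,r)·T₀₁₃(p',q',r')·T₀₂₃(1-q,1-q',w)·T₁₂₃(1-r,1-r',1-w)`,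
`p + p' = δ`; flattening, Lotti–Romani continuity and midpoint convexity bound its cost below by `ω(2,1,2)`,
a certificate makes every step tight (`p ≤ q, r`; LR-tight at `(1,1,w)` with `x = q`, at `(1,1,1-w)` with
`x = r`), and §1 yields `w ≤ α`, `1 - w ≤ α`. -/

section PlacedCover

variable (K : Type) [Field K]

/-- LR-tightness at `(1,1,s)`, `0 ≤ s ≤ 1`, in the form `s ≤ α` (§1 with Coppersmith's flat point
`min(α₀, s/2)`; `s = 0` is trivial). [cite: BurgisserClausenShokrollahi1997, Thm. (15.51)] -/
theorem le_dualExponentAlpha_of_lrTight {s x : ℝ} (hs : 0 ≤ s) (hx : 0 < x) (hx1 : x ≤ 1)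
    (htight : omegaRect K (1 - x) 1 s + x ≤ omegaRect K 1 1 s) : s ≤ dualExponentAlpha K := by
  rcases hs.eq_or_lt with rfl | hs0
  · exact dualExponentAlpha_nonneg K
  have ha0 : 0 < min coppersmithExponent (s / 2) := lt_min coppersmithExponent_pos (by linarith)
  have has : min coppersmithExponent (s / 2) < s := (min_le_right _ _).trans_lt (by linarith)
  have h2 := omegaRect_one_one_eq_two_of_lrTight K ha0 has hx hx1
    (coppersmith1982_omegaRect_eq_two_of_le K (min_le_left _ _)) htight
  rw [← omegaRect_one_mid_one] at h2
  exact le_dualExponentAlpha_of_omegaRect_eq_two K h2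

/-- **Merging** (subadditivity over a finite family): `ω(Σx, Σy, Σz) ≤ Σ ω(x,y,z)`.
[cite: LottiRomani1983, §1 (p. 173)] -/
theorem omegaRect_sum_le_sum_omegaRect {ι : Type*} (s : Finset ι) (x y z : ι → ℝ) :
    omegaRect K (∑ i ∈ s, x i) (∑ i ∈ s, y i) (∑ i ∈ s, z i) ≤
      ∑ i ∈ s, omegaRect K (x i) (y i) (z i) := by
  induction s using Finset.cons_induction with
  | empty => simp [omegaRect_zero_zero_zero]
  | cons i s hi ih =>
    simp only [Finset.sum_cons]
    exact (LottiRomani1983_subadditive K _ _ _ _ _ _).trans (by linarith)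

/-- Midpoint convexity: `2 ω(1,1,½) ≤ ω(1,1,w) + ω(1,1,1-w)` for `0 ≤ w ≤ 1`.
[cite: LottiRomani1983, §2 (p. 174)] -/
theorem two_mul_omegaRect_half_le {w : ℝ} (hw0 : 0 ≤ w) (hw1 : w ≤ 1) :
    2 * omegaRect K 1 1 (1 / 2) ≤ omegaRect K 1 1 w + omegaRect K 1 1 (1 - w) := by
  have h := (omegaRect_convexOn_one_one K).2 (Set.mem_Ici.2 hw0) (Set.mem_Ici.2 (sub_nonneg.2 hw1))
    (show (0 : ℝ) ≤ 1 / 2 by norm_num) (show (0 : ℝ) ≤ 1 / 2 by norm_num) (by norm_num)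
  simp only [smul_eq_mul] at h
  have e : (1 / 2 : ℝ) * w + 1 / 2 * (1 - w) = 1 / 2 := by ring
  rw [e] at h
  linarith

/-- **Normal-form placed cover certificate ⟹ `α ≥ ½`** (the `012`-triangle carries pendant load `p > 0`).
[cite: LottiRomani1983, §1–§2 (pp. 173–174)] [cite: HuangPan1998, §2 eq. (2.8) (p. 262)] -/
theorem half_le_dualExponentAlpha_of_placedCover_core {p p' q q' r r' w : ℝ} (hp : 0 < p)
    (hq : 0 ≤ q) (hq' : 0 ≤ q') (hr : 0 ≤ r) (hr' : 0 ≤ r') (hq1 : q ≤ 1) (hr1 : r ≤ 1)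
    (hw0 : 0 ≤ w) (hw1 : w ≤ 1)
    (hcost : omegaRect K p q r + omegaRect K p' q' r' + omegaRect K (1 - q) (1 - q') w +
      omegaRect K (1 - r) (1 - r') (1 - w) ≤ omegaRect K 2 1 2) :
    1 / 2 ≤ dualExponentAlpha K := by
  have h1 : q + r ≤ omegaRect K p q r := add_le_omegaRect₂₃ K p q r
  have h1a : p + q ≤ omegaRect K p q r := add_le_omegaRect₁₂ K p q r
  have h1b : p + r ≤ omegaRect K p q r := add_le_omegaRect₁₃ K p q r
  have h2 : q' + r' ≤ omegaRect K p' q' r' := add_le_omegaRect₂₃ K p' q' r'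
  have h3 : omegaRect K 1 1 w ≤ omegaRect K (1 - q) (1 - q') w + (q + q') := by
    have := omegaRect_add_le_add_pos K (1 - q) (1 - q') w q q' 0
    simp only [sub_add_cancel, add_zero, max_eq_left hq, max_eq_left hq', max_self] at this
    exact this
  have h4 : omegaRect K 1 1 (1 - w) ≤ omegaRect K (1 - r) (1 - r') (1 - w) + (r + r') := by
    have := omegaRect_add_le_add_pos K (1 - r) (1 - r') (1 - w) r r' 0
    simp only [sub_add_cancel, add_zero, max_eq_left hr, max_eq_left hr', max_self] at this
    exact this
  have h5 := two_mul_omegaRect_half_le K hw0 hw1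
  have h6 := omegaRect_two_one_two_eq_two_mul_half K
  -- every step is tight
  have hqp : p ≤ q := by linarith
  have hrp : p ≤ r := by linarith
  have htq : omegaRect K (1 - q) (1 - q') w + (q + q') ≤ omegaRect K 1 1 w := by linarith
  have htr : omegaRect K (1 - r) (1 - r') (1 - w) + (r + r') ≤ omegaRect K 1 1 (1 - w) := by linarith
  -- two-slot tightness ⟹ one-slot tightness
  have h7 : omegaRect K (1 - q) 1 w ≤ omegaRect K (1 - q) (1 - q') w + q' := by
    have := omegaRect_add_le_add_pos K (1 - q) (1 - q') w 0 q' 0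
    simp only [sub_add_cancel, add_zero, max_eq_left hq', max_self, zero_add] at this
    exact this
  have h8 : omegaRect K (1 - r) 1 (1 - w) ≤ omegaRect K (1 - r) (1 - r') (1 - w) + r' := by
    have := omegaRect_add_le_add_pos K (1 - r) (1 - r') (1 - w) 0 r' 0
    simp only [sub_add_cancel, add_zero, max_eq_left hr', max_self, zero_add] at this
    exact this
  have hw : w ≤ dualExponentAlpha K :=
    le_dualExponentAlpha_of_lrTight K hw0 (hp.trans_le hqp) hq1 (by linarith)
  have hw' : 1 - w ≤ dualExponentAlpha K :=
    le_dualExponentAlpha_of_lrTight K (sub_nonneg.2 hw1) (hp.trans_le hrp) hr1 (by linarith)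
  linarith

/-- **Every placed matrix-multiplication cover certificate of a rung `χ(δ) ≤ ω(2,1,2)`, `δ > 0`, forces
`α ≥ ½`.**  Families: `s₁` = `012`-triangles with loads `(a,b,c)` on `(01,02,12)`; `s₂` = `013`-triangles,
`(a',b',c')` on `(01,03,13)`; `s₃` = `023`-triangles, `(u,v,w)` on `(02,03,23)`; `s₄` = `123`-triangles,
`(u',v',w')` on `(12,13,23)`; six bond equations; cost `≤ ω(2,1,2)`.
[cite: ChristandlVranaZuiddam2016, §1.1] [cite: LottiRomani1983, §1–§2 (pp. 173–174)] -/
theorem half_le_dualExponentAlpha_of_placedCover {ι : Type*} (s₁ s₂ s₃ s₄ : Finset ι)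
    {a b c a' b' c' u v w u' v' w' : ι → ℝ} {δ : ℝ} (hδ : 0 < δ)
    (h₁ : ∀ i ∈ s₁, 0 ≤ a i ∧ 0 ≤ b i ∧ 0 ≤ c i) (h₂ : ∀ i ∈ s₂, 0 ≤ a' i ∧ 0 ≤ b' i ∧ 0 ≤ c' i)
    (h₃ : ∀ i ∈ s₃, 0 ≤ u i ∧ 0 ≤ v i ∧ 0 ≤ w i) (h₄ : ∀ i ∈ s₄, 0 ≤ u' i ∧ 0 ≤ v' i ∧ 0 ≤ w' i)
    (e₀₁ : ∑ i ∈ s₁, a i + ∑ i ∈ s₂, a' i = δ)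
    (e₀₂ : ∑ i ∈ s₁, b i + ∑ i ∈ s₃, u i = 1) (e₁₂ : ∑ i ∈ s₁, c i + ∑ i ∈ s₄, u' i = 1)
    (e₀₃ : ∑ i ∈ s₂, b' i + ∑ i ∈ s₃, v i = 1) (e₁₃ : ∑ i ∈ s₂, c' i + ∑ i ∈ s₄, v' i = 1)
    (e₂₃ : ∑ i ∈ s₃, w i + ∑ i ∈ s₄, w' i = 1)
    (hcost : ∑ i ∈ s₁, omegaRect K (a i) (b i) (c i) + ∑ i ∈ s₂, omegaRect K (a' i) (b' i) (c' i) +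
        ∑ i ∈ s₃, omegaRect K (u i) (v i) (w i) + ∑ i ∈ s₄, omegaRect K (u' i) (v' i) (w' i) ≤
      omegaRect K 2 1 2) :
    1 / 2 ≤ dualExponentAlpha K := by
  -- merge each family
  have m₁ := omegaRect_sum_le_sum_omegaRect K s₁ a b c
  have m₂ := omegaRect_sum_le_sum_omegaRect K s₂ a' b' c'
  have m₃ := omegaRect_sum_le_sum_omegaRect K s₃ u v w
  have m₄ := omegaRect_sum_le_sum_omegaRect K s₄ u' v' w'
  set P := ∑ i ∈ s₁, a i; set Q := ∑ i ∈ s₁, b i; set R := ∑ i ∈ s₁, c i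
  set P' := ∑ i ∈ s₂, a' i; set Q' := ∑ i ∈ s₂, b' i; set R' := ∑ i ∈ s₂, c' i
  set U := ∑ i ∈ s₃, u i; set V := ∑ i ∈ s₃, v i; set W := ∑ i ∈ s₃, w i
  set U' := ∑ i ∈ s₄, u' i; set V' := ∑ i ∈ s₄, v' i; set W' := ∑ i ∈ s₄, w' i
  have hP : 0 ≤ P := Finset.sum_nonneg fun i hi => (h₁ i hi).1
  have hQ : 0 ≤ Q := Finset.sum_nonneg fun i hi => (h₁ i hi).2.1
  have hR : 0 ≤ R := Finset.sum_nonneg fun i hi => (h₁ i hi).2.2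
  have hP' : 0 ≤ P' := Finset.sum_nonneg fun i hi => (h₂ i hi).1
  have hQ' : 0 ≤ Q' := Finset.sum_nonneg fun i hi => (h₂ i hi).2.1
  have hR' : 0 ≤ R' := Finset.sum_nonneg fun i hi => (h₂ i hi).2.2
  have hU : 0 ≤ U := Finset.sum_nonneg fun i hi => (h₃ i hi).1
  have hV : 0 ≤ V := Finset.sum_nonneg fun i hi => (h₃ i hi).2.1
  have hW : 0 ≤ W := Finset.sum_nonneg fun i hi => (h₃ i hi).2.2
  have hU' : 0 ≤ U' := Finset.sum_nonneg fun i hi => (h₄ i hi).1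
  have hV' : 0 ≤ V' := Finset.sum_nonneg fun i hi => (h₄ i hi).2.1
  have hW' : 0 ≤ W' := Finset.sum_nonneg fun i hi => (h₄ i hi).2.2
  have eU : U = 1 - Q := by linarith
  have eV : V = 1 - Q' := by linarith
  have eU' : U' = 1 - R := by linarith
  have eV' : V' = 1 - R' := by linarith
  have eW' : W' = 1 - W := by linarith
  have hcost' : omegaRect K P Q R + omegaRect K P' Q' R' + omegaRect K (1 - Q) (1 - Q') W +
      omegaRect K (1 - R) (1 - R') (1 - W) ≤ omegaRect K 2 1 2 := by
    rw [← eU, ← eV, ← eU', ← eV', ← eW']; linarith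
  rcases hP.eq_or_lt with hP0 | hP0
  · -- the whole pendant sits on the `013`-triangles: swap the parties `2 ↔ 3`
    have hP'0 : 0 < P' := by linarith
    have hcost'' : omegaRect K P' Q' R' + omegaRect K P Q R + omegaRect K (1 - Q') (1 - Q) W +
        omegaRect K (1 - R') (1 - R) (1 - W) ≤ omegaRect K 2 1 2 := by
      rw [omegaRect_swap₁₂ K (1 - Q') (1 - Q) W, omegaRect_swap₁₂ K (1 - R') (1 - R) (1 - W)]
      linarith
    exact half_le_dualExponentAlpha_of_placedCover_core K hP'0 hQ' hQ hR' hR (by linarith)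
      (by linarith) hW (by linarith) hcost''
  · exact half_le_dualExponentAlpha_of_placedCover_core K hP0 hQ hQ' hR hR' (by linarith)
      (by linarith) hW (by linarith) hcost'

end PlacedCover

/-- **Over `ℂ`: a placed cover certificate of any rung proves `HalfAlpha`**; with
`absRung_iff_halfAlpha_and_sixRungPos` the rung it certifies is then absolute (`χ(δ) ≤ 4`), and by §3 the
class does certify a rung as soon as `½ < α`.  The matrix-multiplication cover class is HalfAlpha-complete
for `SixRungPos` at every `δ > 0`. [cite: ChristandlVranaZuiddam2016, §1.1] -/
theorem halfAlpha_of_placedCoverCertificate {ι : Type*} (s₁ s₂ s₃ s₄ : Finset ι)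
    {a b c a' b' c' u v w u' v' w' : ι → ℝ} {δ : ℝ} (hδ : 0 < δ)
    (h₁ : ∀ i ∈ s₁, 0 ≤ a i ∧ 0 ≤ b i ∧ 0 ≤ c i) (h₂ : ∀ i ∈ s₂, 0 ≤ a' i ∧ 0 ≤ b' i ∧ 0 ≤ c' i)
    (h₃ : ∀ i ∈ s₃, 0 ≤ u i ∧ 0 ≤ v i ∧ 0 ≤ w i) (h₄ : ∀ i ∈ s₄, 0 ≤ u' i ∧ 0 ≤ v' i ∧ 0 ≤ w' i)
    (e₀₁ : ∑ i ∈ s₁, a i + ∑ i ∈ s₂, a' i = δ)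
    (e₀₂ : ∑ i ∈ s₁, b i + ∑ i ∈ s₃, u i = 1) (e₁₂ : ∑ i ∈ s₁, c i + ∑ i ∈ s₄, u' i = 1)
    (e₀₃ : ∑ i ∈ s₂, b' i + ∑ i ∈ s₃, v i = 1) (e₁₃ : ∑ i ∈ s₂, c' i + ∑ i ∈ s₄, v' i = 1)
    (e₂₃ : ∑ i ∈ s₃, w i + ∑ i ∈ s₄, w' i = 1)
    (hcost : ∑ i ∈ s₁, omegaRect ℂ (a i) (b i) (c i) + ∑ i ∈ s₂, omegaRect ℂ (a' i) (b' i) (c' i) +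
        ∑ i ∈ s₃, omegaRect ℂ (u i) (v i) (w i) + ∑ i ∈ s₄, omegaRect ℂ (u' i) (v' i) (w' i) ≤
      omegaRect ℂ 2 1 2) : HalfAlpha :=
  half_le_dualExponentAlpha_of_placedCover ℂ s₁ s₂ s₃ s₄ hδ h₁ h₂ h₃ h₄ e₀₁ e₀₂ e₁₂ e₀₃ e₁₃ e₂₃ hcost

end Summit.MatrixMultiplication.MatrixMultiplication.Theorems.EdgePencil
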